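import Summits.HodgeConjecture.CorCM.GaloisTwentyFourC3SemidirectC8Degenerate
import HarnessLib

/-!
# The order-32 group `(C₄ ⋊ C₄) × C₂` is BAD for EVERY complex conjugation (kernel certificates; census row #11)

COR-CM (cell `pub-hodgecm2`), binder seat b04 (gen 27), count-neutral — closes the «computed-only» row #11 of gen 23's ORDER-32
CENSUS (A7-JUNCTION gen-23 table): `G = (C₄ ⋊ C₄) × C₂ = ⟨a, b, z | a⁴ = b⁴ = z² = 1, bab⁻¹ = a⁻¹, z central⟩` (invariants
`|Z| = 8`, `G′ = C₂`, exponent `4`, `7` involutions, `|Φ(G)| = 4`), which has SEVEN central involutions `a^{2i} b^{2j} z^{t}`; the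
census found every column BAD.  Model: `X = ℤ/4 × ℤ/4 × ℤ/2`, `(v, s, t) ↔ a^v b^s z^t`, law
`(v₁,s₁,t₁)(v₂,s₂,t₂) = (v₁ + 3^{s₁}v₂, s₁+s₂, t₁+t₂)`; the hypothesis is a bijection `e : Gal(K/ℚ) ≃ X` multiplicative for this
law (`hmul`) — i.e. `Gal(K/ℚ) ≅ (C₄ ⋊ C₄) × C₂` — and `hc` naming the image of complex conjugation.  For each of the seven a
certificate `(T₀, D)` (PRIMITIVE CM set — no non-trivial left stabiliser at all — and a balanced set of size `4`) was found by SAT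
directly on the certificate conditions (compute job j208763, 19 s) and is checked by `decide` through gen 20's
`GaloisModels.exists_simple_degenerate_of_table_balanced`.  KERNEL ONLY: theorems; no definition, no named fact, no `sorry`.
`HC_CM` is neither used nor claimed.

* `exists_simple_degenerate_of_c4sdc4xc2_balanced` — the format for this law (the identity `e 1 = (0,0,0)` is derived from `hmul`).
* `exists_simple_degenerate_c4sdc4xc2_conj_v_s_t` — the seven instances.

Remaining computed-only rows of the order-32 census: #28, #29, #40, #41 (unnamed in gen 23's table; identify a law first).

## References

* [Shimura1998] G. Shimura, *Abelian Varieties with Complex Multiplication and Modular Functions*, §6.2 Thm. 3, §8.2 Prop. 26.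
* [Gordon1999HodgeAVSurvey] B. B. Gordon, *A survey of the Hodge conjecture for abelian varieties*, Thm. 6.4, §9.3.
-/

noncomputable section

open CategoryTheory CategoryTheory.Limits NumberField
open scoped BigOperators

namespace Summit.HodgeConjecture.CorCM.GaloisModels

open Literature.NumberTheory.ComplexMultiplication
open Literature.AlgebraicGeometry.Motives (AbelianVariety CMType)
open Literature.AlgebraicGeometry.HodgeTheory
open Literature.AlgebraicGeometry.ComplexMultiplication (IsCMTypeRealisation)
open Literature.AlgebraicGeometry.Pohlmann1968
open Literature.Barriers.HodgeConjecture (divisorClassesSpan)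

variable {K : Type} [Field K] [NumberField K] [IsCMField K] [IsGalois ℚ K]

/-- **CERTIFICATE FORMAT for `Gal(K/ℚ) ≅ (C₄ ⋊ C₄) × C₂`** in the coordinates `(v, s, t) ↔ a^v b^s z^t`, law
`(v₁,s₁,t₁)(v₂,s₂,t₂) = (v₁ + 3^{s₁}v₂, s₁+s₂, t₁+t₂)`: a CM set `T₀` for the prescribed complex conjugation `c₀` with trivial left
stabiliser and a balanced `D` with `c₀D ≠ D` give a simple DEGENERATE CM abelian `16`-fold with a `(q,q)` class outside the divisor
ring on a power. [cite: Shimura1998, §6.2 Thm. 3 and §8.2 Prop. 26] [cite: Gordon1999HodgeAVSurvey, Thm. 6.4 and §9.3] -/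
theorem exists_simple_degenerate_of_c4sdc4xc2_balanced (e : (K ≃ₐ[ℚ] K) ≃ ZMod 4 × ZMod 4 × ZMod 2)
    (hmul : ∀ a b : K ≃ₐ[ℚ] K, e (a * b) = ((e a).1 + (3 : ZMod 4) ^ (e a).2.1.val * (e b).1, (e a).2.1 + (e b).2.1, (e a).2.2 + (e b).2.2))
    (c₀ : ZMod 4 × ZMod 4 × ZMod 2) (hc : e ((IsCMField.complexConj K).restrictScalars ℚ) = c₀)
    (T₀ : Finset (ZMod 4 × ZMod 4 × ZMod 2))
    (hcm : ∀ x : ZMod 4 × ZMod 4 × ZMod 2, x ∈ T₀ ↔ (c₀.1 + (3 : ZMod 4) ^ c₀.2.1.val * x.1, c₀.2.1 + x.2.1, c₀.2.2 + x.2.2) ∉ T₀)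
    (hprim : ∀ v : ZMod 4 × ZMod 4 × ZMod 2, v ≠ ((0 : ZMod 4), (0 : ZMod 4), (0 : ZMod 2)) →
      ∃ w : ZMod 4 × ZMod 4 × ZMod 2, ¬ (w ∈ T₀ ↔ (v.1 + (3 : ZMod 4) ^ v.2.1.val * w.1, v.2.1 + w.2.1, v.2.2 + w.2.2) ∈ T₀))
    (D : Finset (ZMod 4 × ZMod 4 × ZMod 2))
    (hbal : ∀ g : ZMod 4 × ZMod 4 × ZMod 2,
      2 * (D.filter fun x => (x.1 + (3 : ZMod 4) ^ x.2.1.val * g.1, x.2.1 + g.2.1, x.2.2 + g.2.2) ∈ T₀).card = D.card)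
    (hmov : ∃ x ∈ D, (c₀.1 + (3 : ZMod 4) ^ c₀.2.1.val * x.1, c₀.2.1 + x.2.1, c₀.2.2 + x.2.2) ∉ D) :
    ∃ (Φ : CMType K) (φ₀ : K →+* ℂ) (A : AbelianVariety ℂ) (ι : 𝓞 K →+* End A)
      (θ : K →+* Module.End ℂ (complexBetti A.X 1)),
      IsPrimitive (ℂ ≃+* ℂ) Φ.1 φ₀ ∧ ¬ IsNondegenerate Φ ∧ IsCMTypeRealisation Φ A ι θ ∧ A.IsSimple ∧ A.dim = 16 ∧
      ∃ m q : ℕ, ∃ x : complexBetti (⨁ fun _ : Fin m => A).X (2 * q), IsRationalClass x ∧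
        IsOfHodgeType (⨁ fun _ : Fin m => A).dim (⨁ fun _ : Fin m => A).X (2 * q) q q x ∧
        x ∉ divisorClassesSpan (⨁ fun _ : Fin m => A).X (⨁ fun _ : Fin m => A).dim q := by
  classical
  have hidem : ∀ x : ZMod 4 × ZMod 4 × ZMod 2,
      (x.1 + (3 : ZMod 4) ^ x.2.1.val * x.1, x.2.1 + x.2.1, x.2.2 + x.2.2) = x → x = ((0 : ZMod 4), (0 : ZMod 4), (0 : ZMod 2)) := by
    decide
  have ho : e 1 = ((0 : ZMod 4), (0 : ZMod 4), (0 : ZMod 2)) := by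
    have h := hmul 1 1
    rw [mul_one] at h
    exact hidem (e 1) h.symm
  have h := exists_simple_degenerate_of_table_balanced
    (fun x y : ZMod 4 × ZMod 4 × ZMod 2 => (x.1 + (3 : ZMod 4) ^ x.2.1.val * y.1, x.2.1 + y.2.1, x.2.2 + y.2.2))
    e hmul c₀ hc _ ho T₀ hcm hprim D hbal hmov
  have hcard : Fintype.card (ZMod 4 × ZMod 4 × ZMod 2) / 2 = 16 := by
    simp [Fintype.card_prod, ZMod.card]
  rwa [hcard] at h

/-- **Row #11, complex conjugation `a^0 b^0 z^1`: `Gal(K/ℚ) ≅ (C₄ ⋊ C₄) × C₂` gives a simple DEGENERATE CM abelian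
`16`-fold** (balanced-set certificate `|D| = 4`, `decide`). [cite: Shimura1998, §6.2 Thm. 3 and §8.2 Prop. 26]
[cite: Gordon1999HodgeAVSurvey, Thm. 6.4 and §9.3] -/
theorem exists_simple_degenerate_c4sdc4xc2_conj_0_0_1 (e : (K ≃ₐ[ℚ] K) ≃ ZMod 4 × ZMod 4 × ZMod 2)
    (hmul : ∀ a b : K ≃ₐ[ℚ] K, e (a * b) = ((e a).1 + (3 : ZMod 4) ^ (e a).2.1.val * (e b).1, (e a).2.1 + (e b).2.1, (e a).2.2 + (e b).2.2))
    (hc : e ((IsCMField.complexConj K).restrictScalars ℚ) = ((0 : ZMod 4), (0 : ZMod 4), (1 : ZMod 2))) :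
    ∃ (Φ : CMType K) (φ₀ : K →+* ℂ) (A : AbelianVariety ℂ) (ι : 𝓞 K →+* End A)
      (θ : K →+* Module.End ℂ (complexBetti A.X 1)),
      IsPrimitive (ℂ ≃+* ℂ) Φ.1 φ₀ ∧ ¬ IsNondegenerate Φ ∧ IsCMTypeRealisation Φ A ι θ ∧ A.IsSimple ∧ A.dim = 16 ∧
      ∃ m q : ℕ, ∃ x : complexBetti (⨁ fun _ : Fin m => A).X (2 * q), IsRationalClass x ∧
        IsOfHodgeType (⨁ fun _ : Fin m => A).dim (⨁ fun _ : Fin m => A).X (2 * q) q q x ∧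
        x ∉ divisorClassesSpan (⨁ fun _ : Fin m => A).X (⨁ fun _ : Fin m => A).dim q :=
  exists_simple_degenerate_of_c4sdc4xc2_balanced e hmul _ hc
    {(0, 0, 0), (0, 1, 1), (0, 2, 0), (0, 3, 0), (1, 0, 1), (1, 1, 0), (1, 2, 1), (1, 3, 0), (2, 0, 1), (2, 1, 1),
    (2, 2, 1), (2, 3, 0), (3, 0, 1), (3, 1, 0), (3, 2, 1), (3, 3, 0)}
    (by decide) (by decide)
    {(1, 2, 1), (1, 3, 1), (3, 0, 1), (3, 1, 1)} (by decide) (by decide)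

/-- **Row #11, complex conjugation `a^0 b^2 z^0`: `Gal(K/ℚ) ≅ (C₄ ⋊ C₄) × C₂` gives a simple DEGENERATE CM abelian
`16`-fold** (balanced-set certificate `|D| = 4`, `decide`). [cite: Shimura1998, §6.2 Thm. 3 and §8.2 Prop. 26]
[cite: Gordon1999HodgeAVSurvey, Thm. 6.4 and §9.3] -/
theorem exists_simple_degenerate_c4sdc4xc2_conj_0_2_0 (e : (K ≃ₐ[ℚ] K) ≃ ZMod 4 × ZMod 4 × ZMod 2)
    (hmul : ∀ a b : K ≃ₐ[ℚ] K, e (a * b) = ((e a).1 + (3 : ZMod 4) ^ (e a).2.1.val * (e b).1, (e a).2.1 + (e b).2.1, (e a).2.2 + (e b).2.2))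
    (hc : e ((IsCMField.complexConj K).restrictScalars ℚ) = ((0 : ZMod 4), (2 : ZMod 4), (0 : ZMod 2))) :
    ∃ (Φ : CMType K) (φ₀ : K →+* ℂ) (A : AbelianVariety ℂ) (ι : 𝓞 K →+* End A)
      (θ : K →+* Module.End ℂ (complexBetti A.X 1)),
      IsPrimitive (ℂ ≃+* ℂ) Φ.1 φ₀ ∧ ¬ IsNondegenerate Φ ∧ IsCMTypeRealisation Φ A ι θ ∧ A.IsSimple ∧ A.dim = 16 ∧
      ∃ m q : ℕ, ∃ x : complexBetti (⨁ fun _ : Fin m => A).X (2 * q), IsRationalClass x ∧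
        IsOfHodgeType (⨁ fun _ : Fin m => A).dim (⨁ fun _ : Fin m => A).X (2 * q) q q x ∧
        x ∉ divisorClassesSpan (⨁ fun _ : Fin m => A).X (⨁ fun _ : Fin m => A).dim q :=
  exists_simple_degenerate_of_c4sdc4xc2_balanced e hmul _ hc
    {(0, 0, 0), (0, 2, 1), (0, 3, 0), (0, 3, 1), (1, 0, 0), (1, 2, 1), (1, 3, 0), (1, 3, 1), (2, 0, 1), (2, 1, 0),
    (2, 1, 1), (2, 2, 0), (3, 0, 1), (3, 2, 0), (3, 3, 0), (3, 3, 1)}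
    (by decide) (by decide)
    {(1, 1, 1), (1, 3, 0), (3, 1, 1), (3, 3, 0)} (by decide) (by decide)

/-- **Row #11, complex conjugation `a^0 b^2 z^1`: `Gal(K/ℚ) ≅ (C₄ ⋊ C₄) × C₂` gives a simple DEGENERATE CM abelian
`16`-fold** (balanced-set certificate `|D| = 4`, `decide`). [cite: Shimura1998, §6.2 Thm. 3 and §8.2 Prop. 26]
[cite: Gordon1999HodgeAVSurvey, Thm. 6.4 and §9.3] -/
theorem exists_simple_degenerate_c4sdc4xc2_conj_0_2_1 (e : (K ≃ₐ[ℚ] K) ≃ ZMod 4 × ZMod 4 × ZMod 2)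
    (hmul : ∀ a b : K ≃ₐ[ℚ] K, e (a * b) = ((e a).1 + (3 : ZMod 4) ^ (e a).2.1.val * (e b).1, (e a).2.1 + (e b).2.1, (e a).2.2 + (e b).2.2))
    (hc : e ((IsCMField.complexConj K).restrictScalars ℚ) = ((0 : ZMod 4), (2 : ZMod 4), (1 : ZMod 2))) :
    ∃ (Φ : CMType K) (φ₀ : K →+* ℂ) (A : AbelianVariety ℂ) (ι : 𝓞 K →+* End A)
      (θ : K →+* Module.End ℂ (complexBetti A.X 1)),
      IsPrimitive (ℂ ≃+* ℂ) Φ.1 φ₀ ∧ ¬ IsNondegenerate Φ ∧ IsCMTypeRealisation Φ A ι θ ∧ A.IsSimple ∧ A.dim = 16 ∧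
      ∃ m q : ℕ, ∃ x : complexBetti (⨁ fun _ : Fin m => A).X (2 * q), IsRationalClass x ∧
        IsOfHodgeType (⨁ fun _ : Fin m => A).dim (⨁ fun _ : Fin m => A).X (2 * q) q q x ∧
        x ∉ divisorClassesSpan (⨁ fun _ : Fin m => A).X (⨁ fun _ : Fin m => A).dim q :=
  exists_simple_degenerate_of_c4sdc4xc2_balanced e hmul _ hc
    {(0, 0, 1), (0, 1, 1), (0, 2, 1), (0, 3, 1), (1, 0, 0), (1, 2, 0), (1, 3, 0), (1, 3, 1), (2, 0, 0), (2, 1, 0),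
    (2, 2, 0), (2, 3, 0), (3, 0, 0), (3, 2, 0), (3, 3, 0), (3, 3, 1)}
    (by decide) (by decide)
    {(0, 0, 1), (0, 3, 0), (2, 1, 1), (2, 2, 0)} (by decide) (by decide)

/-- **Row #11, complex conjugation `a^2 b^0 z^0`: `Gal(K/ℚ) ≅ (C₄ ⋊ C₄) × C₂` gives a simple DEGENERATE CM abelian
`16`-fold** (balanced-set certificate `|D| = 4`, `decide`). [cite: Shimura1998, §6.2 Thm. 3 and §8.2 Prop. 26]
[cite: Gordon1999HodgeAVSurvey, Thm. 6.4 and §9.3] -/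
theorem exists_simple_degenerate_c4sdc4xc2_conj_2_0_0 (e : (K ≃ₐ[ℚ] K) ≃ ZMod 4 × ZMod 4 × ZMod 2)
    (hmul : ∀ a b : K ≃ₐ[ℚ] K, e (a * b) = ((e a).1 + (3 : ZMod 4) ^ (e a).2.1.val * (e b).1, (e a).2.1 + (e b).2.1, (e a).2.2 + (e b).2.2))
    (hc : e ((IsCMField.complexConj K).restrictScalars ℚ) = ((2 : ZMod 4), (0 : ZMod 4), (0 : ZMod 2))) :
    ∃ (Φ : CMType K) (φ₀ : K →+* ℂ) (A : AbelianVariety ℂ) (ι : 𝓞 K →+* End A)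
      (θ : K →+* Module.End ℂ (complexBetti A.X 1)),
      IsPrimitive (ℂ ≃+* ℂ) Φ.1 φ₀ ∧ ¬ IsNondegenerate Φ ∧ IsCMTypeRealisation Φ A ι θ ∧ A.IsSimple ∧ A.dim = 16 ∧
      ∃ m q : ℕ, ∃ x : complexBetti (⨁ fun _ : Fin m => A).X (2 * q), IsRationalClass x ∧
        IsOfHodgeType (⨁ fun _ : Fin m => A).dim (⨁ fun _ : Fin m => A).X (2 * q) q q x ∧
        x ∉ divisorClassesSpan (⨁ fun _ : Fin m => A).X (⨁ fun _ : Fin m => A).dim q :=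
  exists_simple_degenerate_of_c4sdc4xc2_balanced e hmul _ hc
    {(0, 0, 0), (0, 0, 1), (0, 2, 0), (0, 3, 0), (1, 0, 1), (1, 1, 1), (1, 3, 0), (1, 3, 1), (2, 1, 0), (2, 1, 1),
    (2, 2, 1), (2, 3, 1), (3, 0, 0), (3, 1, 0), (3, 2, 0), (3, 2, 1)}
    (by decide) (by decide)
    {(0, 1, 1), (0, 3, 1), (3, 0, 0), (3, 2, 0)} (by decide) (by decide)

/-- **Row #11, complex conjugation `a^2 b^0 z^1`: `Gal(K/ℚ) ≅ (C₄ ⋊ C₄) × C₂` gives a simple DEGENERATE CM abelian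
`16`-fold** (balanced-set certificate `|D| = 4`, `decide`). [cite: Shimura1998, §6.2 Thm. 3 and §8.2 Prop. 26]
[cite: Gordon1999HodgeAVSurvey, Thm. 6.4 and §9.3] -/
theorem exists_simple_degenerate_c4sdc4xc2_conj_2_0_1 (e : (K ≃ₐ[ℚ] K) ≃ ZMod 4 × ZMod 4 × ZMod 2)
    (hmul : ∀ a b : K ≃ₐ[ℚ] K, e (a * b) = ((e a).1 + (3 : ZMod 4) ^ (e a).2.1.val * (e b).1, (e a).2.1 + (e b).2.1, (e a).2.2 + (e b).2.2))
    (hc : e ((IsCMField.complexConj K).restrictScalars ℚ) = ((2 : ZMod 4), (0 : ZMod 4), (1 : ZMod 2))) :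
    ∃ (Φ : CMType K) (φ₀ : K →+* ℂ) (A : AbelianVariety ℂ) (ι : 𝓞 K →+* End A)
      (θ : K →+* Module.End ℂ (complexBetti A.X 1)),
      IsPrimitive (ℂ ≃+* ℂ) Φ.1 φ₀ ∧ ¬ IsNondegenerate Φ ∧ IsCMTypeRealisation Φ A ι θ ∧ A.IsSimple ∧ A.dim = 16 ∧
      ∃ m q : ℕ, ∃ x : complexBetti (⨁ fun _ : Fin m => A).X (2 * q), IsRationalClass x ∧
        IsOfHodgeType (⨁ fun _ : Fin m => A).dim (⨁ fun _ : Fin m => A).X (2 * q) q q x ∧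
        x ∉ divisorClassesSpan (⨁ fun _ : Fin m => A).X (⨁ fun _ : Fin m => A).dim q :=
  exists_simple_degenerate_of_c4sdc4xc2_balanced e hmul _ hc
    {(0, 0, 0), (0, 2, 0), (0, 2, 1), (1, 2, 1), (1, 3, 0), (1, 3, 1), (2, 0, 0), (2, 1, 0), (2, 1, 1), (2, 3, 0),
    (2, 3, 1), (3, 0, 0), (3, 0, 1), (3, 1, 0), (3, 1, 1), (3, 2, 1)}
    (by decide) (by decide)
    {(0, 1, 1), (1, 3, 1), (2, 1, 1), (3, 3, 1)} (by decide) (by decide)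

/-- **Row #11, complex conjugation `a^2 b^2 z^0`: `Gal(K/ℚ) ≅ (C₄ ⋊ C₄) × C₂` gives a simple DEGENERATE CM abelian
`16`-fold** (balanced-set certificate `|D| = 4`, `decide`). [cite: Shimura1998, §6.2 Thm. 3 and §8.2 Prop. 26]
[cite: Gordon1999HodgeAVSurvey, Thm. 6.4 and §9.3] -/
theorem exists_simple_degenerate_c4sdc4xc2_conj_2_2_0 (e : (K ≃ₐ[ℚ] K) ≃ ZMod 4 × ZMod 4 × ZMod 2)
    (hmul : ∀ a b : K ≃ₐ[ℚ] K, e (a * b) = ((e a).1 + (3 : ZMod 4) ^ (e a).2.1.val * (e b).1, (e a).2.1 + (e b).2.1, (e a).2.2 + (e b).2.2))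
    (hc : e ((IsCMField.complexConj K).restrictScalars ℚ) = ((2 : ZMod 4), (2 : ZMod 4), (0 : ZMod 2))) :
    ∃ (Φ : CMType K) (φ₀ : K →+* ℂ) (A : AbelianVariety ℂ) (ι : 𝓞 K →+* End A)
      (θ : K →+* Module.End ℂ (complexBetti A.X 1)),
      IsPrimitive (ℂ ≃+* ℂ) Φ.1 φ₀ ∧ ¬ IsNondegenerate Φ ∧ IsCMTypeRealisation Φ A ι θ ∧ A.IsSimple ∧ A.dim = 16 ∧
      ∃ m q : ℕ, ∃ x : complexBetti (⨁ fun _ : Fin m => A).X (2 * q), IsRationalClass x ∧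
        IsOfHodgeType (⨁ fun _ : Fin m => A).dim (⨁ fun _ : Fin m => A).X (2 * q) q q x ∧
        x ∉ divisorClassesSpan (⨁ fun _ : Fin m => A).X (⨁ fun _ : Fin m => A).dim q :=
  exists_simple_degenerate_of_c4sdc4xc2_balanced e hmul _ hc
    {(0, 0, 0), (0, 3, 0), (1, 0, 0), (1, 0, 1), (1, 2, 1), (1, 3, 0), (2, 0, 0), (2, 0, 1), (2, 1, 1), (2, 2, 1),
    (2, 3, 0), (2, 3, 1), (3, 0, 0), (3, 1, 1), (3, 3, 0), (3, 3, 1)}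
    (by decide) (by decide)
    {(1, 0, 0), (1, 1, 0), (1, 2, 0), (1, 3, 0)} (by decide) (by decide)

/-- **Row #11, complex conjugation `a^2 b^2 z^1`: `Gal(K/ℚ) ≅ (C₄ ⋊ C₄) × C₂` gives a simple DEGENERATE CM abelian
`16`-fold** (balanced-set certificate `|D| = 4`, `decide`). [cite: Shimura1998, §6.2 Thm. 3 and §8.2 Prop. 26]
[cite: Gordon1999HodgeAVSurvey, Thm. 6.4 and §9.3] -/
theorem exists_simple_degenerate_c4sdc4xc2_conj_2_2_1 (e : (K ≃ₐ[ℚ] K) ≃ ZMod 4 × ZMod 4 × ZMod 2)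
    (hmul : ∀ a b : K ≃ₐ[ℚ] K, e (a * b) = ((e a).1 + (3 : ZMod 4) ^ (e a).2.1.val * (e b).1, (e a).2.1 + (e b).2.1, (e a).2.2 + (e b).2.2))
    (hc : e ((IsCMField.complexConj K).restrictScalars ℚ) = ((2 : ZMod 4), (2 : ZMod 4), (1 : ZMod 2))) :
    ∃ (Φ : CMType K) (φ₀ : K →+* ℂ) (A : AbelianVariety ℂ) (ι : 𝓞 K →+* End A)
      (θ : K →+* Module.End ℂ (complexBetti A.X 1)),
      IsPrimitive (ℂ ≃+* ℂ) Φ.1 φ₀ ∧ ¬ IsNondegenerate Φ ∧ IsCMTypeRealisation Φ A ι θ ∧ A.IsSimple ∧ A.dim = 16 ∧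
      ∃ m q : ℕ, ∃ x : complexBetti (⨁ fun _ : Fin m => A).X (2 * q), IsRationalClass x ∧
        IsOfHodgeType (⨁ fun _ : Fin m => A).dim (⨁ fun _ : Fin m => A).X (2 * q) q q x ∧
        x ∉ divisorClassesSpan (⨁ fun _ : Fin m => A).X (⨁ fun _ : Fin m => A).dim q :=
  exists_simple_degenerate_of_c4sdc4xc2_balanced e hmul _ hc
    {(0, 0, 1), (0, 1, 0), (0, 1, 1), (0, 2, 1), (0, 3, 0), (0, 3, 1), (1, 1, 0), (1, 1, 1), (2, 0, 1), (2, 2, 1),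
    (3, 0, 0), (3, 0, 1), (3, 1, 0), (3, 1, 1), (3, 2, 0), (3, 2, 1)}
    (by decide) (by decide)
    {(0, 0, 1), (0, 2, 0), (1, 1, 1), (1, 3, 0)} (by decide) (by decide)

end Summit.HodgeConjecture.CorCM.GaloisModels

end
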